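import Literature.MathematicalPhysics.QuantumFieldTheory.Balaban1983to89.B7Prop1Local
import Literature.MathematicalPhysics.QuantumFieldTheory.Balaban1983to89.B10Eq27AxialLog

/-!
# `Balaban1983to89.B10Eq44AvgRegularity` — T. Bałaban, *Ultraviolet stability of three-dimensional lattice pure gauge
# field theories*, Commun. Math. Phys. **102** (1985) 255–275 [Balaban1985UV3]: the sentence before (44) p. 267 —
# *regularity of `U_k` ⇒ regularity of all the averages `Ū_k^j`, `j ≤ k`* — and the loop-variable factor of (44),
# PROVED for the concrete `j`-fold block average (43) of [4] on `ℤ^d` (theorems only)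

statement-level skeleton of published theorems with citation tags; proofs where landed; nothing here is a claim
about the Yang–Mills mass gap

PDF held: `paper:balaban1985-cmp102-uv-stability-3d` (journal page = PDF page + 254); p. 267 (PDF 13) read from the
render `pub-balaban/b2b-balaban-ref1/pages/1985-cmp102-uv-stability-3d/1985-cmp102-uv-stability-3d-p013-x2.png` as an
image.  "[4]" = T. Bałaban, *Averaging operations for lattice gauge theories*, CMP **98** (1985) [Balaban1985Averaging]
(cell paper B7): Prop. 2 (52)–(54) p. 26 with its induction (53), PROVED in the tree for the concrete average
(`B7Prop2Explicit.ineq53_explicit`, `B7Prop2SpecialUnitary.ineq53_explicit_at`; locality `B7Prop1Local`).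

WHAT IS REPRODUCED (mega-formalization `lit-balaban`, HOME `run/shared/lean/pub/lit-balaban/`, Phase-2 proof seat
`p29` gen 5, unit `lit-balaban-p29`, file 1/2 of SKELETON row `B10.Eq44` (reader r07's `ROWS-B10.md`); file 2/2
`B10Eq44Concrete` derives (44) itself in the letters of r07's leaf `B10SectCExpansion.Bound44`).  THE PRINTED TEXT
(p. 267, verbatim): *"The configuration `U_k` satisfies the following regularity condition on `Ω_k`: `|U_k(∂p) − 1| <
2L²B₃g_{k−1}p(g_{k−1})η²`. This implies the condition `|Ū_k^j(∂p′) − 1| < 4L²B₃g_{k−1}p(g_{k−1})(L^jη)²` for `p′ ⊂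
Ω_k^{(j)}`, and from (43) we get `|𝒫_j(Y_j, U_k)| ≤ O(1) Π_{i=1}^n exp(−κ₁(M₁L^jη)^{−1}|c_{i,−} − y|) × (L^jη)^{−1}|c_{i,−}
− y| 8L²B₃g_{k−1}p(g_{k−1})(L^jη)²`. (44)"* ((43) p. 266: `B_k(c) = (1/i) log Ū_k^j(Γ_{y,c₋} ∪ c ∪ Γ_{c₊,y})`).  For the
CONCRETE `j`-fold average `Ū^j = B7Prop2Explicit.avgIter L U j` on `ℤ^d` this file proves:
* §1 — [4] (53)–(54) AT EVERY LEVEL `j ≤ k` (the form print consumes here and at p. 273 (68)–(69)): (52) `sup_p |U(∂p)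
  − 1| < α₀η²`, `η = L^{−k}`, `C₀α₀ ≤ ⅓`, `2α₀ ≤ c₂′` ⟹ `sup_{p′ ⊂ Ω^{(j)}} |Ū^j(∂p′) − 1| < 2α₀(L^jη)²`
  (`avg_level_lt_two`; gauge groups closed under (42) at radius `t`: `avg_level_lt_two_at`), and WITH THE PRINTED
  LOCALITY of [4] p. 26 — (52) only on the unit plaquettes of the four `j`-blocks at the corners of `p′`
  (`avg_level_lt_two_local(_at)`, by the clamped extension `B7Prop1Local.clampCfg`).  Mechanism = [4] p. 26: (53) at
  level `j` (tree) and *"the right-hand side can be bounded by `α₀ + C₀α₀²2 < 2α₀`"* carried out at scale `(L^jη)²`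
  (`level53_lt`).
* §2 — THE p. 267 SENTENCE (`ε` = the number `g_{k−1}p(g_{k−1})`, `α₀ = 2L²B₃ε`): `|U_k(∂p) − 1| < 2L²B₃εη²` ⟹
  `|Ū_k^j(∂p′) − 1| < 4L²B₃ε(L^jη)²`, `j ≤ k` — global (`reg44_avg`, `reg44_avg_plaq`, `G`-valuedness `reg44_avg_mem`),
  with the printed locality "on `Ω_k`" = on the four `j`-blocks at the corners of `p′ ⊂ Ω_k^{(j)}` (`reg44_avg_local(_at)`),
  and for the paper's groups `U(N)`, `SU(N) ⊂ M_N(ℂ)`, operator norm (`reg44_avg_unitaryGroup`, `reg44_avg_specialUnitary`).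
* §3 — THE FACTOR OF (44): the loop variable `B_k(c)` of (43) IS `B10Eq27AxialLog.B27 (avgIter L U j) y c₋ μ`, and
  `|B_k(c)| ≤ |c₋ − y|₁ · 8L²B₃ε(L^jη)²` on every bond with `|c₋ − y|₁·4L²B₃ε(L^jη)² ≤ ½` (`loop44_le`: the ladder (28)
  `B10Eq27AxialLog.norm_B27_le` fed with §2).
MODEL NOTES (referee columns F6/F7).  (M1) LATTICES as in `B7Prop2Explicit` (header DICTIONARY): `ηℤ^d ≅ ℤ^d`,
`Ω_k^{(j)} = L^jηℤ^d ≅ ℤ^d`, `Ū_k^j(∂p′)`, `p′ = (z; μ, ν)` ↦ `hol (avgIter L U j) z (plaqWord μ ν)`, `η² ↦ ((L^k)⁻¹)²`,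
`(L^jη)² ↦ (L^j(L^k)⁻¹)²`; no torus, no subdomain: "on `Ω_k`" is rendered by the local theorems (hypothesis on the four
`j`-blocks at the corners of `p′`, which lie in `Ω_k` when `p′ ⊂ Ω_k^{(j)}`, `Ω_k` being a union of blocks (39)); the
global theorems assume the regularity on all of `ηℤ^d`.  (M2) `U_k` is ANY configuration with the printed regularity
(print: the minimizer of [7]; p. 270 *"for an arbitrary configuration having the same properties and bounds as `U_k`"*,
cell GAPS G-B10-05); `pdev < …` (a genuine supremum) renders "for all plaquettes".  (M3) SMALLNESS *"for `g_{k−1}`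
sufficiently small"* explicit: `C₀·2L²B₃ε ≤ ⅓`, `4L²B₃ε ≤ c₂′(d, L)`, `0 < L²B₃ε` ([4] Prop. 2's `α₀ ≤ c₂`); in §3 the
bond restriction `|c₋ − y|₁·4L²B₃ε(L^jη)² ≤ ½` (print: `|c_{i,−} − y| < R(g_j)M₁L^jη` and `g_{k−1}` small).  (M4) GAUGE
GROUP: any subgroup of `{|u| ≤ 1, |u⁻¹| ≤ 1}` of a complete normed `ℂ`-algebra closed under the average (42)
(`AvgClosed`; radius-`t` version `AvgClosedAt`); instances `U(N)` (`avgClosed_unitaryUnits`) and `SU(N)`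
(`avgClosedAt_specialUnitary`, one extra smallness `N·32(d+1)(d+4)L²α₀ < π`).  (M5) `d ≥ 1` arbitrary (print `d = 3`),
`L ≥ 2`; `|c₋ − y|` read as the `ℓ¹` lattice length (the length of the tree contour `Γ_{y,c₋}` in the ladder (28)).
No `sorry`, no definitions, no new named facts; axioms `propext`, `Classical.choice`, `Quot.sound`.
-/

noncomputable section

open scoped BigOperators
open NormedSpace Finset

namespace Literature.MathematicalPhysics.QuantumFieldTheory.Balaban1983to89.B10Eq44AvgRegularity

open B7Prop1Explicit B7Prop2Explicit B7Prop2SpecialUnitary B7Prop1Local MatrixLog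
open B10Eq27AxialLog (B27 norm_B27_le)

export B7Prop1Explicit (Site) -- the `ℤ^d` sites (the torus `Site` of `Setup.lean` would shadow them)

variable {d : ℕ}

/-! ## §0 Arithmetic of [4] p. 26 at scale `(L^jη)²` -/

/-- The bracket of (53), `1 + L^{−2}(1+C₀α₀)² + … + (L^{−2}(1+C₀α₀)²)^{j−1} ≤ 2` for `L ≥ 2`, `C₀α₀ ≤ ⅓` ([4] p. 26:
*"if `L^{−2}(1 + C₀α₀)² < ½`. The last inequality holds if, e.g., `C₀α₀ ≤ ⅓`"*; tree `B7.geom_bracket_le_two`,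
`B7.prop2_ratio_lt_half`). [cite: Balaban1985Averaging, (53) p.26] -/
theorem bracket53_le_two {L : ℕ} (hL : 2 ≤ L) {α₀ : ℝ} (hα : 0 < α₀) (hα3 : C0 d * α₀ ≤ 1 / 3) (j : ℕ) :
    ∑ i ∈ Finset.range j, ((1 + C0 d * α₀) ^ 2 / (L : ℝ) ^ 2) ^ i ≤ 2 := by
  have hC := C0_pos d
  have hLr : (2 : ℝ) ≤ L := by exact_mod_cast hL
  exact B7.geom_bracket_le_two _ (by positivity)
    (B7.prop2_ratio_lt_half (C0 d) α₀ L hLr (by positivity) hα3).le j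

/-- [4] p. 26 *"The right-hand side can be bounded by `α₀ + C₀α₀²2` … and then `α₀ + C₀α₀²2 < 2α₀`"* carried out AT
SCALE `t² = (L^jη)² ≤ 1`: `α₀t² + C₀(α₀t²)²·S < 2α₀t²` for `S ≤ 2`, `C₀α₀ ≤ ⅓`, `0 < t ≤ 1`. [cite: Balaban1985Averaging, (53)–(54) p.26] -/
theorem level53_lt {C₀ α₀ t S : ℝ} (hC : 0 ≤ C₀) (hα : 0 < α₀) (hα3 : C₀ * α₀ ≤ 1 / 3) (ht0 : 0 < t)
    (ht : t ≤ 1) (hS : S ≤ 2) :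
    α₀ * t ^ 2 + C₀ * (α₀ * t ^ 2) ^ 2 * S < 2 * α₀ * t ^ 2 := by
  have ht2 : t ^ 2 ≤ 1 := pow_le_one₀ ht0.le ht
  have hpos : 0 < α₀ * t ^ 2 := by positivity
  have h1 : C₀ * (α₀ * t ^ 2) ^ 2 * S ≤ 2 * (C₀ * α₀) * (α₀ * t ^ 2) * t ^ 2 := by
    have hx : (α₀ * t ^ 2) ^ 2 = α₀ * (α₀ * t ^ 2) * t ^ 2 := by ring
    rw [hx]
    have h := mul_le_mul_of_nonneg_left hS (by positivity : 0 ≤ C₀ * (α₀ * (α₀ * t ^ 2) * t ^ 2))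
    linarith [h]
  have h2 : 2 * (C₀ * α₀) * (α₀ * t ^ 2) * t ^ 2 ≤ 2 * (1 / 3) * (α₀ * t ^ 2) * 1 := by
    apply mul_le_mul _ ht2 (by positivity) (by positivity)
    exact mul_le_mul_of_nonneg_right (by linarith) hpos.le
  linarith

/-- `2α₀ ≤ c₂′(d, L)` puts the closure radius `32(d+1)(d+4)L²α₀` of the average below `¼`
(`B7Prop2Explicit.AvgClosed` = closed at radius `¼`). [folklore] -/
private theorem radius_le_quarter {L : ℕ} (hL : 2 ≤ L) {α₀ : ℝ} (hα2 : 2 * α₀ ≤ c2' d L) :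
    32 * ((d : ℝ) + 1) * (d + 4) * (L : ℝ) ^ 2 * α₀ ≤ 1 / 4 := by
  have hL1 : (1 : ℝ) ≤ L := by exact_mod_cast le_trans (by norm_num) hL
  have hpos : (0 : ℝ) < 512 * ((d : ℝ) + 1) * (d + 4) * (L : ℝ) ^ 2 := by positivity
  have h1 : 2 * α₀ ≤ 1 / (512 * ((d : ℝ) + 1) * (d + 4) * (L : ℝ) ^ 2) := hα2
  rw [le_div_iff₀ hpos] at h1
  linarith

/-! ## §1 [4] (53)–(54) at every level `j ≤ k`: `|Ū^j(∂p′) − 1| < 2α₀(L^jη)²` -/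

section LevelJ

variable {𝔸 : Type*} [NormedRing 𝔸] [NormOneClass 𝔸] [NormedAlgebra ℂ 𝔸] [CompleteSpace 𝔸]

/-- `L^j η = L^j (L^k)⁻¹ ∈ (0, 1]` for `j ≤ k`, `L ≥ 2`. [folklore] -/
private theorem scale_pos_le_one {L : ℕ} (hL : 2 ≤ L) {j k : ℕ} (hj : j ≤ k) :
    0 < (L : ℝ) ^ j * ((L : ℝ) ^ k)⁻¹ ∧ (L : ℝ) ^ j * ((L : ℝ) ^ k)⁻¹ ≤ 1 := by
  have hLr : (2 : ℝ) ≤ L := by exact_mod_cast hL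
  have hL0 : (0 : ℝ) < L := by linarith
  refine ⟨by positivity, ?_⟩
  rw [← div_eq_mul_inv, div_le_one (by positivity)]
  exact pow_le_pow_right₀ (by linarith) hj

/-- **[4] (53)–(54) AT EVERY LEVEL, gauge group closed under (42) at radius `t`:** under (52) `sup_p |U(∂p) − 1| <
α₀η²`, `η = L^{−k}`, with `C₀α₀ ≤ ⅓`, `2α₀ ≤ c₂′`, `32(d+1)(d+4)L²α₀ ≤ t`, for every `j ≤ k`:
`sup_{p′ ⊂ Ω^{(j)}} |Ū^j(∂p′) − 1| < 2α₀(L^jη)²` — (53) at level `j` (`ineq53_explicit_at`) and the p. 26 bound of its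
right-hand side done at scale `(L^jη)²` (`level53_lt`).  This is the form in which [Balaban1985UV3] p. 267 (and p. 273
(68)–(69)) consume Proposition 2 of [4] for the intermediate averages `Ū_k^j`, `j < k`. [cite: Balaban1985Averaging, (53)–(54) p.26] -/
theorem avg_level_lt_two_at (L : ℕ) (hL : 2 ≤ L) {G : Subgroup 𝔸ˣ} {t : ℝ} (hG : AvgClosedAt d t L G) (k : ℕ)
    (V : Site d → Fin d → 𝔸ˣ) (hV : ∀ x κ, V x κ ∈ G) {α₀ : ℝ} (hα : 0 < α₀)
    (hα3 : C0 d * α₀ ≤ 1 / 3) (hα2 : 2 * α₀ ≤ c2' d L)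
    (hαt : 32 * ((d : ℝ) + 1) * (d + 4) * (L : ℝ) ^ 2 * α₀ ≤ t)
    (h52 : pdev V < α₀ * (((L : ℝ) ^ k)⁻¹) ^ 2) :
    ∀ j ≤ k, pdev (avgIter L V j) < 2 * α₀ * ((L : ℝ) ^ j * ((L : ℝ) ^ k)⁻¹) ^ 2 := by
  intro j hj
  obtain ⟨ht0, ht1⟩ := scale_pos_le_one (L := L) hL hj
  exact (ineq53_explicit_at L hL hG k V hV hα hα3 hα2 hαt h52 j hj).trans
    (level53_lt (C0_pos d).le hα hα3 ht0 ht1 (bracket53_le_two hL hα hα3 j))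

/-- **[4] (53)–(54) AT EVERY LEVEL** for an `AvgClosed` gauge group (closure radius `¼`, e.g. `U(N)`): (52) with
`C₀α₀ ≤ ⅓`, `2α₀ ≤ c₂′` ⟹ `sup_{p′ ⊂ Ω^{(j)}} |Ū^j(∂p′) − 1| < 2α₀(L^jη)²` for every `j ≤ k`. [cite: Balaban1985Averaging, (53)–(54) p.26] -/
theorem avg_level_lt_two (L : ℕ) (hL : 2 ≤ L) {G : Subgroup 𝔸ˣ} (hG : AvgClosed d L G) (k : ℕ)
    (V : Site d → Fin d → 𝔸ˣ) (hV : ∀ x κ, V x κ ∈ G) {α₀ : ℝ} (hα : 0 < α₀)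
    (hα3 : C0 d * α₀ ≤ 1 / 3) (hα2 : 2 * α₀ ≤ c2' d L)
    (h52 : pdev V < α₀ * (((L : ℝ) ^ k)⁻¹) ^ 2) :
    ∀ j ≤ k, pdev (avgIter L V j) < 2 * α₀ * ((L : ℝ) ^ j * ((L : ℝ) ^ k)⁻¹) ^ 2 := by
  intro j hj
  obtain ⟨ht0, ht1⟩ := scale_pos_le_one (L := L) hL hj
  exact (ineq53_explicit L hL hG k V hV hα hα3 hα2 h52 j hj).trans
    (level53_lt (C0_pos d).le hα hα3 ht0 ht1 (bracket53_le_two hL hα hα3 j))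

/-- The same at a single plaquette `p′ = (z; μ, ν)` of `Ω^{(j)}`: `|Ū^j(∂p′) − 1| < 2α₀(L^jη)²`, `j ≤ k` (radius-`t`
group). [cite: Balaban1985Averaging, (53)–(54) p.26] -/
theorem avg_level_lt_two_plaq_at (L : ℕ) (hL : 2 ≤ L) {G : Subgroup 𝔸ˣ} {t : ℝ} (hG : AvgClosedAt d t L G)
    (k : ℕ) (V : Site d → Fin d → 𝔸ˣ) (hV : ∀ x κ, V x κ ∈ G) {α₀ : ℝ} (hα : 0 < α₀)
    (hα3 : C0 d * α₀ ≤ 1 / 3) (hα2 : 2 * α₀ ≤ c2' d L)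
    (hαt : 32 * ((d : ℝ) + 1) * (d + 4) * (L : ℝ) ^ 2 * α₀ ≤ t)
    (h52 : pdev V < α₀ * (((L : ℝ) ^ k)⁻¹) ^ 2) {j : ℕ} (hj : j ≤ k) (z : Site d) (μ ν : Fin d) :
    ‖((hol (avgIter L V j) z (plaqWord μ ν) : 𝔸ˣ) : 𝔸) - 1‖ < 2 * α₀ * ((L : ℝ) ^ j * ((L : ℝ) ^ k)⁻¹) ^ 2 := by
  have hmem := avgIter_mem_at L hL hG k V hV hα hα3 hα2 hαt h52 j hj
  have hjU : ∀ x κ, avgIter L V j x κ ∈ U1 𝔸 := fun x κ => hG.le_U1 (hmem x κ)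
  exact (le_pdev hjU z μ ν).trans_lt (avg_level_lt_two_at L hL hG k V hV hα hα3 hα2 hαt h52 j hj)

/-- **[4] (53)–(54) AT EVERY LEVEL WITH THE PRINTED LOCALITY** ([4] p. 26, after (54): *"it is enough to assume (52)
for `p ⊂ B^k(x) ∪ B^k(y) ∪ B^k(z) ∪ B^k(w)`"*), radius-`t` group: if (52) holds for the unit plaquettes inside the
four `j`-blocks at the corners of the plaquette `p′ = (z; μ, ν)` of `Ω^{(j)}` (`B7Prop1Local.pdevOn` over the box
`[L^jz, L^jz + (L^j − 1)𝟙 + L^je_μ + L^je_ν]`), then `|Ū^j(∂p′) − 1| < 2α₀(L^jη)²`.  Proof: the clamped extension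
(`B7Prop1Local.clampCfg`) satisfies (52) everywhere and has the same `Ū^j(∂p′)` (`hol_plaqWord_avgIter_congr`).
[cite: Balaban1985Averaging, (53)–(54) p.26 + the sentence after (54)] -/
theorem avg_level_lt_two_local_at (L : ℕ) (hL : 2 ≤ L) {G : Subgroup 𝔸ˣ} {t : ℝ} (hG : AvgClosedAt d t L G)
    (k : ℕ) (V : Site d → Fin d → 𝔸ˣ) (hV : ∀ x κ, V x κ ∈ G) {α₀ : ℝ} (hα : 0 < α₀)
    (hα3 : C0 d * α₀ ≤ 1 / 3) (hα2 : 2 * α₀ ≤ c2' d L)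
    (hαt : 32 * ((d : ℝ) + 1) * (d + 4) * (L : ℝ) ^ 2 * α₀ ≤ t) {j : ℕ} (hj : j ≤ k) (z : Site d)
    (μ ν : Fin d) (h52 : pdevOn (loK L j z) (plaqHiK L j z μ ν) V < α₀ * (((L : ℝ) ^ k)⁻¹) ^ 2) :
    ‖((hol (avgIter L V j) z (plaqWord μ ν) : 𝔸ˣ) : 𝔸) - 1‖ < 2 * α₀ * ((L : ℝ) ^ j * ((L : ℝ) ^ k)⁻¹) ^ 2 := by
  have hL1 : 1 ≤ L := le_trans (by norm_num) hL
  have hP : (1 : ℤ) ≤ (L : ℤ) ^ j := one_le_pow₀ (by exact_mod_cast hL1)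
  have hlohi : ∀ i, loK L j z i ≤ plaqHiK L j z μ ν i := fun i => by
    simp only [loK, plaqHiK]; split_ifs <;> linarith
  set V' := clampCfg (loK L j z) (plaqHiK L j z μ ν) V with hV'
  have hV'G : ∀ x κ, V' x κ ∈ G := clampCfg_mem hV
  have hVU : ∀ x κ, V x κ ∈ U1 𝔸 := fun x κ => hG.le_U1 (hV x κ)
  have h52' : pdev V' < α₀ * (((L : ℝ) ^ k)⁻¹) ^ 2 := (pdev_clampCfg_le hlohi hVU).trans_lt h52
  rw [hol_plaqWord_avgIter_congr L hL1 j z μ ν (clampCfg_agree V).symm]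
  exact avg_level_lt_two_plaq_at L hL hG k V' hV'G hα hα3 hα2 hαt h52' hj z μ ν

/-- **[4] (53)–(54) AT EVERY LEVEL WITH THE PRINTED LOCALITY**, `AvgClosed` group (e.g. `U(N)`).
[cite: Balaban1985Averaging, (53)–(54) p.26 + the sentence after (54)] -/
theorem avg_level_lt_two_local (L : ℕ) (hL : 2 ≤ L) {G : Subgroup 𝔸ˣ} (hG : AvgClosed d L G) (k : ℕ)
    (V : Site d → Fin d → 𝔸ˣ) (hV : ∀ x κ, V x κ ∈ G) {α₀ : ℝ} (hα : 0 < α₀)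
    (hα3 : C0 d * α₀ ≤ 1 / 3) (hα2 : 2 * α₀ ≤ c2' d L) {j : ℕ} (hj : j ≤ k) (z : Site d) (μ ν : Fin d)
    (h52 : pdevOn (loK L j z) (plaqHiK L j z μ ν) V < α₀ * (((L : ℝ) ^ k)⁻¹) ^ 2) :
    ‖((hol (avgIter L V j) z (plaqWord μ ν) : 𝔸ˣ) : 𝔸) - 1‖ < 2 * α₀ * ((L : ℝ) ^ j * ((L : ℝ) ^ k)⁻¹) ^ 2 :=
  avg_level_lt_two_local_at L hL (avgClosedAt_of_avgClosed hG le_rfl) k V hV hα hα3 hα2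
    (radius_le_quarter hL hα2) hj z μ ν h52

end LevelJ

/-! ## §2 The sentence before (44), p. 267: `|U_k(∂p) − 1| < 2L²B₃εη²` ⟹ `|Ū_k^j(∂p′) − 1| < 4L²B₃ε(L^jη)²` -/

section Reg44

variable {𝔸 : Type*} [NormedRing 𝔸] [NormOneClass 𝔸] [NormedAlgebra ℂ 𝔸] [CompleteSpace 𝔸]

/-- **p. 267, the sentence before (44), radius-`t` gauge group** (`ε` stands for the number `g_{k−1}p(g_{k−1})`):
*"The configuration `U_k` satisfies the following regularity condition on `Ω_k`: `|U_k(∂p) − 1| < 2L²B₃g_{k−1}p(g_{k−1})η²`.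
This implies the condition `|Ū_k^j(∂p′) − 1| < 4L²B₃g_{k−1}p(g_{k−1})(L^jη)²` for `p′ ⊂ Ω_k^{(j)}`"* — for the concrete
`j`-fold average on `ℤ^d`, every `j ≤ k`, with [4] Prop. 2's smallness for `α₀ = 2L²B₃ε` explicit. [cite: Balaban1985UV3, p.267 (sentence before (44))] -/
theorem reg44_avg_at (L : ℕ) (hL : 2 ≤ L) {G : Subgroup 𝔸ˣ} {t : ℝ} (hG : AvgClosedAt d t L G) (k : ℕ)
    (U : Site d → Fin d → 𝔸ˣ) (hU : ∀ x κ, U x κ ∈ G) {B₃ ε : ℝ} (hpos : 0 < (L : ℝ) ^ 2 * B₃ * ε)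
    (hα3 : C0 d * (2 * (L : ℝ) ^ 2 * B₃ * ε) ≤ 1 / 3) (hα2 : 2 * (2 * (L : ℝ) ^ 2 * B₃ * ε) ≤ c2' d L)
    (hαt : 32 * ((d : ℝ) + 1) * (d + 4) * (L : ℝ) ^ 2 * (2 * (L : ℝ) ^ 2 * B₃ * ε) ≤ t)
    (hreg : pdev U < 2 * (L : ℝ) ^ 2 * B₃ * ε * (((L : ℝ) ^ k)⁻¹) ^ 2) :
    ∀ j ≤ k, pdev (avgIter L U j) < 4 * (L : ℝ) ^ 2 * B₃ * ε * ((L : ℝ) ^ j * ((L : ℝ) ^ k)⁻¹) ^ 2 := by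
  intro j hj
  have h := avg_level_lt_two_at L hL hG k U hU (by linarith) hα3 hα2 hαt hreg j hj
  convert h using 1
  ring

/-- **p. 267, the sentence before (44)**, `AvgClosed` gauge group (e.g. `U(N)`): `|U_k(∂p) − 1| < 2L²B₃εη²` on all
plaquettes ⟹ `sup_{p′ ⊂ Ω_k^{(j)}} |Ū_k^j(∂p′) − 1| < 4L²B₃ε(L^jη)²`, `j ≤ k`. [cite: Balaban1985UV3, p.267 (sentence before (44))] -/
theorem reg44_avg (L : ℕ) (hL : 2 ≤ L) {G : Subgroup 𝔸ˣ} (hG : AvgClosed d L G) (k : ℕ)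
    (U : Site d → Fin d → 𝔸ˣ) (hU : ∀ x κ, U x κ ∈ G) {B₃ ε : ℝ} (hpos : 0 < (L : ℝ) ^ 2 * B₃ * ε)
    (hα3 : C0 d * (2 * (L : ℝ) ^ 2 * B₃ * ε) ≤ 1 / 3) (hα2 : 2 * (2 * (L : ℝ) ^ 2 * B₃ * ε) ≤ c2' d L)
    (hreg : pdev U < 2 * (L : ℝ) ^ 2 * B₃ * ε * (((L : ℝ) ^ k)⁻¹) ^ 2) :
    ∀ j ≤ k, pdev (avgIter L U j) < 4 * (L : ℝ) ^ 2 * B₃ * ε * ((L : ℝ) ^ j * ((L : ℝ) ^ k)⁻¹) ^ 2 :=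
  reg44_avg_at L hL (avgClosedAt_of_avgClosed hG le_rfl) k U hU hpos hα3 hα2 (radius_le_quarter hL hα2) hreg

/-- The `G`-valuedness of every `Ū_k^j`, `j ≤ k`, under the p. 267 regularity (tacit in print; [4] p. 26 via the
tree's `B7Prop2Explicit.avgIter_mem`). [cite: Balaban1985UV3, p.267 (sentence before (44))] -/
theorem reg44_avg_mem (L : ℕ) (hL : 2 ≤ L) {G : Subgroup 𝔸ˣ} (hG : AvgClosed d L G) (k : ℕ)
    (U : Site d → Fin d → 𝔸ˣ) (hU : ∀ x κ, U x κ ∈ G) {B₃ ε : ℝ} (hpos : 0 < (L : ℝ) ^ 2 * B₃ * ε)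
    (hα3 : C0 d * (2 * (L : ℝ) ^ 2 * B₃ * ε) ≤ 1 / 3) (hα2 : 2 * (2 * (L : ℝ) ^ 2 * B₃ * ε) ≤ c2' d L)
    (hreg : pdev U < 2 * (L : ℝ) ^ 2 * B₃ * ε * (((L : ℝ) ^ k)⁻¹) ^ 2) :
    ∀ j ≤ k, ∀ x κ, avgIter L U j x κ ∈ G :=
  avgIter_mem L hL hG k U hU (by linarith) hα3 hα2 hreg

/-- **p. 267, the sentence before (44), at a plaquette:** `|Ū_k^j(∂p′) − 1| < 4L²B₃ε(L^jη)²` for every plaquette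
`p′ = (z; μ, ν)` of `Ω_k^{(j)}`, `j ≤ k` (`AvgClosed` group). [cite: Balaban1985UV3, p.267 (sentence before (44))] -/
theorem reg44_avg_plaq (L : ℕ) (hL : 2 ≤ L) {G : Subgroup 𝔸ˣ} (hG : AvgClosed d L G) (k : ℕ)
    (U : Site d → Fin d → 𝔸ˣ) (hU : ∀ x κ, U x κ ∈ G) {B₃ ε : ℝ} (hpos : 0 < (L : ℝ) ^ 2 * B₃ * ε)
    (hα3 : C0 d * (2 * (L : ℝ) ^ 2 * B₃ * ε) ≤ 1 / 3) (hα2 : 2 * (2 * (L : ℝ) ^ 2 * B₃ * ε) ≤ c2' d L)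
    (hreg : pdev U < 2 * (L : ℝ) ^ 2 * B₃ * ε * (((L : ℝ) ^ k)⁻¹) ^ 2) {j : ℕ} (hj : j ≤ k) (z : Site d)
    (μ ν : Fin d) :
    ‖((hol (avgIter L U j) z (plaqWord μ ν) : 𝔸ˣ) : 𝔸) - 1‖
      < 4 * (L : ℝ) ^ 2 * B₃ * ε * ((L : ℝ) ^ j * ((L : ℝ) ^ k)⁻¹) ^ 2 := by
  have hjU : ∀ x κ, avgIter L U j x κ ∈ U1 𝔸 := fun x κ =>
    hG.le_U1 (reg44_avg_mem L hL hG k U hU hpos hα3 hα2 hreg j hj x κ)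
  exact (le_pdev hjU z μ ν).trans_lt (reg44_avg L hL hG k U hU hpos hα3 hα2 hreg j hj)

/-- **p. 267, the sentence before (44), WITH THE PRINTED LOCALITY "on `Ω_k`"**, radius-`t` group: if
`|U_k(∂p) − 1| < 2L²B₃εη²` holds for the unit plaquettes `p` inside the four `j`-blocks at the corners of the plaquette
`p′ = (z; μ, ν)` of `Ω_k^{(j)}` (these blocks lie in `Ω_k` when `p′ ⊂ Ω_k^{(j)}`, `Ω_k` being a union of blocks (39)),
then `|Ū_k^j(∂p′) − 1| < 4L²B₃ε(L^jη)²`. [cite: Balaban1985UV3, p.267 (sentence before (44))] -/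
theorem reg44_avg_local_at (L : ℕ) (hL : 2 ≤ L) {G : Subgroup 𝔸ˣ} {t : ℝ} (hG : AvgClosedAt d t L G) (k : ℕ)
    (U : Site d → Fin d → 𝔸ˣ) (hU : ∀ x κ, U x κ ∈ G) {B₃ ε : ℝ} (hpos : 0 < (L : ℝ) ^ 2 * B₃ * ε)
    (hα3 : C0 d * (2 * (L : ℝ) ^ 2 * B₃ * ε) ≤ 1 / 3) (hα2 : 2 * (2 * (L : ℝ) ^ 2 * B₃ * ε) ≤ c2' d L)
    (hαt : 32 * ((d : ℝ) + 1) * (d + 4) * (L : ℝ) ^ 2 * (2 * (L : ℝ) ^ 2 * B₃ * ε) ≤ t)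
    {j : ℕ} (hj : j ≤ k) (z : Site d) (μ ν : Fin d)
    (hreg : pdevOn (loK L j z) (plaqHiK L j z μ ν) U < 2 * (L : ℝ) ^ 2 * B₃ * ε * (((L : ℝ) ^ k)⁻¹) ^ 2) :
    ‖((hol (avgIter L U j) z (plaqWord μ ν) : 𝔸ˣ) : 𝔸) - 1‖
      < 4 * (L : ℝ) ^ 2 * B₃ * ε * ((L : ℝ) ^ j * ((L : ℝ) ^ k)⁻¹) ^ 2 := by
  have h := avg_level_lt_two_local_at L hL hG k U hU (by linarith) hα3 hα2 hαt hj z μ ν hreg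
  convert h using 1
  ring

/-- **p. 267, the sentence before (44), WITH THE PRINTED LOCALITY "on `Ω_k`"**, `AvgClosed` group (e.g. `U(N)`).
[cite: Balaban1985UV3, p.267 (sentence before (44))] -/
theorem reg44_avg_local (L : ℕ) (hL : 2 ≤ L) {G : Subgroup 𝔸ˣ} (hG : AvgClosed d L G) (k : ℕ)
    (U : Site d → Fin d → 𝔸ˣ) (hU : ∀ x κ, U x κ ∈ G) {B₃ ε : ℝ} (hpos : 0 < (L : ℝ) ^ 2 * B₃ * ε)
    (hα3 : C0 d * (2 * (L : ℝ) ^ 2 * B₃ * ε) ≤ 1 / 3) (hα2 : 2 * (2 * (L : ℝ) ^ 2 * B₃ * ε) ≤ c2' d L)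
    {j : ℕ} (hj : j ≤ k) (z : Site d) (μ ν : Fin d)
    (hreg : pdevOn (loK L j z) (plaqHiK L j z μ ν) U < 2 * (L : ℝ) ^ 2 * B₃ * ε * (((L : ℝ) ^ k)⁻¹) ^ 2) :
    ‖((hol (avgIter L U j) z (plaqWord μ ν) : 𝔸ˣ) : 𝔸) - 1‖
      < 4 * (L : ℝ) ^ 2 * B₃ * ε * ((L : ℝ) ^ j * ((L : ℝ) ^ k)⁻¹) ^ 2 :=
  reg44_avg_local_at L hL (avgClosedAt_of_avgClosed hG le_rfl) k U hU hpos hα3 hα2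
    (radius_le_quarter hL hα2) hj z μ ν hreg

end Reg44

section Matrices

open scoped Matrix.Norms.L2Operator

/-- **p. 267, the sentence before (44), for `G = U(N)`, `N ≥ 1`, operator norm (19) of [4], printed locality:**
regularity of `U_k` on the four `j`-blocks at the corners of `p′` ⟹ `|Ū_k^j(∂p′) − 1| < 4L²B₃ε(L^jη)²`.
[cite: Balaban1985UV3, p.267 (sentence before (44))] -/
theorem reg44_avg_unitaryGroup (N : ℕ) [NeZero N] (L : ℕ) (hL : 2 ≤ L) (k : ℕ)
    (U : Site d → Fin d → (Matrix (Fin N) (Fin N) ℂ)ˣ)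
    (hU : ∀ x κ, U x κ ∈ unitaryUnits (Matrix (Fin N) (Fin N) ℂ)) {B₃ ε : ℝ}
    (hpos : 0 < (L : ℝ) ^ 2 * B₃ * ε) (hα3 : C0 d * (2 * (L : ℝ) ^ 2 * B₃ * ε) ≤ 1 / 3)
    (hα2 : 2 * (2 * (L : ℝ) ^ 2 * B₃ * ε) ≤ c2' d L) {j : ℕ} (hj : j ≤ k) (z : Site d) (μ ν : Fin d)
    (hreg : pdevOn (loK L j z) (plaqHiK L j z μ ν) U < 2 * (L : ℝ) ^ 2 * B₃ * ε * (((L : ℝ) ^ k)⁻¹) ^ 2) :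
    ‖((hol (avgIter L U j) z (plaqWord μ ν) : (Matrix (Fin N) (Fin N) ℂ)ˣ) : Matrix (Fin N) (Fin N) ℂ) - 1‖
      < 4 * (L : ℝ) ^ 2 * B₃ * ε * ((L : ℝ) ^ j * ((L : ℝ) ^ k)⁻¹) ^ 2 := by
  letI : CStarAlgebra (Matrix (Fin N) (Fin N) ℂ) := {}
  exact reg44_avg_local L hL (avgClosed_unitaryUnits d L) k U hU hpos hα3 hα2 hj z μ ν hreg

variable {n : Type*} [Fintype n] [DecidableEq n] [Nonempty n]

/-- **p. 267, the sentence before (44), for `G = SU(N) ⊂ M_N(ℂ)`, operator norm, printed locality** (Theorem 1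
p. 257: *"a semi-simple compact Lie group `G`"*); the closure radius of `avgClosedAt_specialUnitary` costs the one
`G`-dependent smallness `N·32(d+1)(d+4)L²·2L²B₃ε < π`. [cite: Balaban1985UV3, p.267 (sentence before (44))] -/
theorem reg44_avg_specialUnitary (L : ℕ) (hL : 2 ≤ L) (k : ℕ) (U : Site d → Fin d → (Matrix n n ℂ)ˣ)
    (hU : ∀ x κ, U x κ ∈ specialUnitaryUnits n) {B₃ ε : ℝ} (hpos : 0 < (L : ℝ) ^ 2 * B₃ * ε)
    (hα3 : C0 d * (2 * (L : ℝ) ^ 2 * B₃ * ε) ≤ 1 / 3) (hα2 : 2 * (2 * (L : ℝ) ^ 2 * B₃ * ε) ≤ c2' d L)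
    (hαN : Fintype.card n * (32 * ((d : ℝ) + 1) * (d + 4) * (L : ℝ) ^ 2 * (2 * (L : ℝ) ^ 2 * B₃ * ε)) < Real.pi)
    {j : ℕ} (hj : j ≤ k) (z : Site d) (μ ν : Fin d)
    (hreg : pdevOn (loK L j z) (plaqHiK L j z μ ν) U < 2 * (L : ℝ) ^ 2 * B₃ * ε * (((L : ℝ) ^ k)⁻¹) ^ 2) :
    ‖((hol (avgIter L U j) z (plaqWord μ ν) : (Matrix n n ℂ)ˣ) : Matrix n n ℂ) - 1‖
      < 4 * (L : ℝ) ^ 2 * B₃ * ε * ((L : ℝ) ^ j * ((L : ℝ) ^ k)⁻¹) ^ 2 := by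
  letI : CStarAlgebra (Matrix n n ℂ) := {}
  have ht4 := radius_le_quarter (d := d) hL hα2
  exact reg44_avg_local_at L hL (avgClosedAt_specialUnitary d L ht4 hαN) k U hU hpos hα3 hα2 le_rfl hj z μ ν hreg

end Matrices

/-! ## §3 The loop variables `B_k(c) = (1/i) log Ū_k^j(Γ_{y,c₋} ∪ c ∪ Γ_{c₊,y})` of (43) and the factor of (44) -/

section Loop

variable {𝔸 : Type*} [NormedRing 𝔸] [NormOneClass 𝔸] [NormedAlgebra ℂ 𝔸] [CompleteSpace 𝔸]

/-- **The factor of (44)** (`ε` = `g_{k−1}p(g_{k−1})`): under the p. 267 regularity of `U_k`, the loop variable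
`B_k(c) = (1/i) log Ū_k^j(Γ_{y,c₋} ∪ c ∪ Γ_{c₊,y})` of (43) — the tree's (27)-configuration `B10Eq27AxialLog.B27` of the
concrete `Ū_k^j`, bond `c = ⟨x, x + e_μ⟩` of `Ω_k^{(j)}` — satisfies `|B_k(c)| ≤ |c₋ − y|₁ · 8L²B₃ε(L^jη)²` (`=
(L^jη)^{−1}|c₋ − y| · 8L²B₃g_{k−1}p(g_{k−1})(L^jη)²` with `|·|` the `ℓ¹` lattice length), on every bond with
`|c₋ − y|₁·4L²B₃ε(L^jη)² ≤ ½`: the ladder (28) `B10Eq27AxialLog.norm_B27_le` fed with §2. [cite: Balaban1985UV3, (44) p.267] -/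
theorem loop44_le (L : ℕ) (hL : 2 ≤ L) {G : Subgroup 𝔸ˣ} (hG : AvgClosed d L G) (k : ℕ)
    (U : Site d → Fin d → 𝔸ˣ) (hU : ∀ x κ, U x κ ∈ G) {B₃ ε : ℝ} (hpos : 0 < (L : ℝ) ^ 2 * B₃ * ε)
    (hα3 : C0 d * (2 * (L : ℝ) ^ 2 * B₃ * ε) ≤ 1 / 3) (hα2 : 2 * (2 * (L : ℝ) ^ 2 * B₃ * ε) ≤ c2' d L)
    (hreg : pdev U < 2 * (L : ℝ) ^ 2 * B₃ * ε * (((L : ℝ) ^ k)⁻¹) ^ 2) {j : ℕ} (hj : j ≤ k) (y x : Site d)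
    (μ : Fin d)
    (hsmall : (l1 (x - y) : ℝ) * (4 * (L : ℝ) ^ 2 * B₃ * ε * ((L : ℝ) ^ j * ((L : ℝ) ^ k)⁻¹) ^ 2) ≤ 1 / 2) :
    ‖B27 (avgIter L U j) y x μ‖
      ≤ (l1 (x - y) : ℝ) * (8 * (L : ℝ) ^ 2 * B₃ * ε * ((L : ℝ) ^ j * ((L : ℝ) ^ k)⁻¹) ^ 2) := by
  have hjU : ∀ x κ, avgIter L U j x κ ∈ U1 𝔸 := fun x κ =>
    hG.le_U1 (reg44_avg_mem L hL hG k U hU hpos hα3 hα2 hreg j hj x κ)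
  have h44 : ∀ (x : Site d) (κ μ : Fin d), κ ≠ μ →
      ‖((hol (avgIter L U j) x (plaqWord κ μ) : 𝔸ˣ) : 𝔸) - 1‖
        ≤ 4 * (L : ℝ) ^ 2 * B₃ * ε * ((L : ℝ) ^ j * ((L : ℝ) ^ k)⁻¹) ^ 2 :=
    fun x κ μ _ => (reg44_avg_plaq L hL hG k U hU hpos hα3 hα2 hreg hj x κ μ).le
  obtain ⟨ht0, -⟩ := scale_pos_le_one (L := L) hL hj
  have h4 : (0 : ℝ) ≤ 4 * (L : ℝ) ^ 2 * B₃ * ε * ((L : ℝ) ^ j * ((L : ℝ) ^ k)⁻¹) ^ 2 := by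
    have h := mul_pos hpos (pow_pos ht0 2)
    linarith
  have h := norm_B27_le (avgIter L U j) hjU y h44 h4 x μ hsmall
  convert h using 1
  ring

end Loop

end Literature.MathematicalPhysics.QuantumFieldTheory.Balaban1983to89.B10Eq44AvgRegularity

end
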